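import Literature.AnabelianGeometry.EtaleTheta.SettingModelGfpChiTempered
import Literature.AnabelianGeometry.SemiGraphs.TemperedCurveBridge
import Literature.AnabelianGeometry.SemiGraphs.TemperedCurveGalois
import Literature.AnabelianGeometry.AbsoluteAnabelian.SubpadicSlimProofs
import Literature.AnabelianGeometry.AbsoluteAnabelian.SubpadicExamples

/-!
# The χ-twisted root model of [EtTh] §1 (R78 (B)): the group-level datum of `curveχ` — slimness of
# `Π^tp_X = Γ ⋊_χ G_{ℚ_p}` and of `Δ^tp_X`, and the CONDITIONAL assembly of `GroupLevelData (curveχ p)`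

Mochizuki, *Semi-graphs of anabelioids*, Publ. RIMS **42** (2006) [SemiAnbd], Example 3.10 p. 43:
"`π₁^temp(X_K)` is a tempered topological group", "Note that `Δ` is also tempered", "both `Π` and `Δ` are
temp-slim" [cite: MochizukiSemiAnbd2006, Ex 3.10 p.43]; [EtTh] §1 p. 12 (`Π^tp_X`, `G_K`)
[cite: MochizukiEtTh2009, §1 p.12]; [FrdI] §0 p. 13 (slim topological groups) [cite: MochizukiFrdI2008, §0 p.13].
abc-iut cell, layer L2, R78 cluster (χ-twisted root model; abc-iut-L2-lead RULINGS #13 R100), seat abc-iut-w5-d249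
(F4 author: `SettingModelSemidirectTopology` p429197, `SettingModelChiSemidirect` p429710), self-named row
«η′ GroupLevelData at curveχ, conditional assembly» (STATUS 2026-08-26T07:25Z).  PROOF-ONLY (no definition):

* `Semidirect.isSlimGroup_of` — GENERIC: if `N` and `G` are slim and `N ⋊[φ] G` carries a topology for which
  `g ↦ (g.left, g.right)` is inducing, then `N ⋊[φ] G` is slim (an element `⟨γ, σ⟩` centralising an open `H`
  commutes with `inr (H ∩ G)`, so `σ` centralises an open subgroup of `G`, `σ = 1`; then `γ` centralises the
  open `H ∩ N`, `γ = 1`);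
* `IsSlimGroup.of_continuousMulEquiv'` — slimness is invariant under isomorphisms of topological groups;
* `isSlimGroup_PiTpχ (hΓ)` — `Π^tp_X = Γ ⋊_χ G_{ℚ_p}` is slim, GIVEN `hΓ : IsSlimGroup Γ` (and abc-iut-L4's PROVED
  `IsSubpadicFor.isSlimGroup_absoluteGaloisGroup` at `IsSubpadicFor.padic p`: `G_{ℚ_p}` is slim, [pGC] Lem 15.8);
* `isSlimGroup_deltaTempχ (hΓ)` — `Δ^tp_X = inl(Γ) ≃ₜ* Γ` is slim, GIVEN `hΓ`;
* **`nonempty_groupLevelData_curveχ (hΓ) (hsc)`** — abc-iut-L3's parameter bundle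
  `TemperedCurve.GroupLevelData (curveχ p)` is INHABITED given the two classical inputs carried BY NAME as
  binders: `hΓ : IsSlimGroup Γ` («open subgroups of the free profinite group `F̂₂` are centre-free», whence
  `Γ = F̂₂ ×_Ẑ ℤ` slim — not in the tree) and `hsc : SecondCountableTopology (PiTpχ p)` (⟸ second countability
  of `F̂₂` and of `G_{ℚ_p}` — not in the tree); all other fields are THEOREMS: `galEquiv :=` abc-iut-L3-t12's
  `galoisIdentification`, `isTempered`/`isTempered_ker :=` abc-iut-w5-d111's `isTempered_PiTpχ` /
  `isTempered_deltaTemp_curveχ` (p430102), through `ker_augK`; hence `exists_toTemperedArithmeticGroup_curveχ`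
  — the bridge of ruling η fires at the χ-twisted model with `Π := Γ ⋊_χ G_{ℚ_p}`.

HONEST LABEL: semi-synthetic model, consistency evidence only (not the tempered `π₁` of a curve); the two binders are
genuine classical statements, NOT [EtTh] facts, and are NOT proved here; nothing of [EtTh]/[SemiAnbd] is asserted;
nothing here bears on [IUTchIII] Cor. 3.12.
-/

noncomputable section

namespace Literature.AnabelianGeometry.EtaleTheta.SettingModel

open Literature.AnabelianGeometry.SemiGraphs Literature.AlgebraicGeometry.Frobenioids _root_.Topology Function

/-! ### Slimness is invariant under isomorphisms of topological groups -/

/-- Slimness transports along an isomorphism of topological groups (public copy of a lemma the tree holds only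
privately). [cite: MochizukiFrdI2008, §0 p.13] -/
theorem IsSlimGroup.of_continuousMulEquiv' {A B : Type*} [Group A] [TopologicalSpace A] [Group B]
    [TopologicalSpace B] (e : A ≃ₜ* B) (hA : IsSlimGroup A) : IsSlimGroup B := by
  refine ⟨fun H hH => ?_⟩
  rw [eq_bot_iff]
  intro z hz
  rw [Subgroup.mem_bot]
  -- pull back to `A`
  have hH' : IsOpen ((H.comap e.toMulEquiv.toMonoidHom : Subgroup A) : Set A) := hH.preimage e.continuous
  have hz' : e.symm z ∈ Subgroup.centralizer ((H.comap e.toMulEquiv.toMonoidHom : Subgroup A) : Set A) := by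
    rw [Subgroup.mem_centralizer_iff]
    intro a ha
    apply e.injective
    have h1 : e a ∈ H := ha
    have h2 := (Subgroup.mem_centralizer_iff.mp hz) (e a) h1
    simpa [map_mul] using h2
  rw [hA.centralizer_eq_bot _ hH', Subgroup.mem_bot] at hz'
  simpa using congrArg e hz'

/-! ### GENERIC: a semidirect product of slim groups is slim -/

namespace Semidirect

variable {N G : Type*} [Group N] [Group G] {φ : G →* MulAut N} [TopologicalSpace N] [TopologicalSpace G]
  [TopologicalSpace (N ⋊[φ] G)]

/-- **`N ⋊[φ] G` is slim when `N` and `G` are** (for a topology making `g ↦ (g.left, g.right)` inducing): an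
element `⟨γ, σ⟩` centralising an open subgroup `H` commutes with `inr b` for `b` in the open `H ∩ G`, which forces
`σ` to centralise `H ∩ G` — so `σ = 1` — and then `γ` centralises the open `H ∩ N`, so `γ = 1`.
[cite: MochizukiFrdI2008, §0 p.13] -/
theorem isSlimGroup_of (hι : IsInducing fun g : N ⋊[φ] G => (g.left, g.right)) (hN : IsSlimGroup N)
    (hG : IsSlimGroup G) : IsSlimGroup (N ⋊[φ] G) := by
  refine ⟨fun H hH => ?_⟩
  rw [eq_bot_iff]
  intro z hz
  rw [Subgroup.mem_bot]
  rw [Subgroup.mem_centralizer_iff] at hz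
  -- the open slices
  let A : Subgroup N := H.comap (SemidirectProduct.inl : N →* N ⋊[φ] G)
  let B : Subgroup G := H.comap (SemidirectProduct.inr : G →* N ⋊[φ] G)
  have hAo : IsOpen (A : Set N) := hH.preimage (continuous_inl hι)
  have hBo : IsOpen (B : Set G) := hH.preimage (continuous_inr hι)
  -- `z.right` centralises `B`
  have hσ : z.right ∈ Subgroup.centralizer (B : Set G) := by
    rw [Subgroup.mem_centralizer_iff]
    intro b hb
    have h := congrArg SemidirectProduct.right (hz (SemidirectProduct.inr b) hb)
    simpa [SemidirectProduct.mul_right] using h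
  rw [hG.centralizer_eq_bot _ hBo, Subgroup.mem_bot] at hσ
  -- `z.left` centralises `A`
  have hγ : z.left ∈ Subgroup.centralizer (A : Set N) := by
    rw [Subgroup.mem_centralizer_iff]
    intro a ha
    have h := congrArg SemidirectProduct.left (hz (SemidirectProduct.inl a) ha)
    simp only [SemidirectProduct.mul_left, SemidirectProduct.left_inl, SemidirectProduct.right_inl, map_one,
      MulAut.one_apply, hσ] at h
    exact h
  rw [hN.centralizer_eq_bot _ hAo, Subgroup.mem_bot] at hγ
  exact SemidirectProduct.ext (by simpa using hγ) (by simpa using hσ)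

end Semidirect

/-! ### At the χ-twisted model -/

variable (p : ℕ) [Fact p.Prime]

/-- **`Π^tp_X = Γ ⋊_χ G_{ℚ_p}` is slim**, GIVEN the slimness of `Γ = F̂₂ ×_Ẑ ℤ` (binder `hΓ`); `G_{ℚ_p}` is slim by
abc-iut-L4's PROVED `IsSubpadicFor.isSlimGroup_absoluteGaloisGroup` ([pGC] Lem 15.8, as in abc-iut-L3's
`TemperedCurve.isSlimGroup_GQp`). [cite: MochizukiSemiAnbd2006, Ex 3.10 p.43] -/
theorem isSlimGroup_PiTpχ (hΓ : IsSlimGroup Gfp) : IsSlimGroup (PiTpχ p) :=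
  Semidirect.isSlimGroup_of (isInducing_leftRightχ p) hΓ
    (Literature.AnabelianGeometry.AbsoluteAnabelian.IsSubpadicFor.isSlimGroup_absoluteGaloisGroup
      (Literature.AnabelianGeometry.AbsoluteAnabelian.AbsTopIII.IsSubpadicFor.padic p))

/-- **`Δ^tp_X` of the χ-twisted model is slim**, GIVEN `hΓ`: `Δ^tp_X = {g | g.right = 1} = inl(Γ) ≃ₜ* Γ`.
[cite: MochizukiSemiAnbd2006, Ex 3.10 p.43] -/
theorem isSlimGroup_deltaTempχ (hΓ : IsSlimGroup Gfp) : IsSlimGroup (curveχ p).DeltaTemp := by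
  -- the isomorphism of topological groups `Γ ≃ₜ* Δ^tp_X`, `γ ↦ inl γ`
  let e : Gfp ≃ₜ* (curveχ p).DeltaTemp :=
    { toFun := fun γ => ⟨SemidirectProduct.inl γ, inl_mem_deltaTempχ p γ⟩
      invFun := fun g => g.1.left
      left_inv := fun γ => rfl
      right_inv := fun g => by
        apply Subtype.ext
        change SemidirectProduct.inl g.1.left = g.1
        have hg : g.1.right = 1 := (mem_deltaTempχ_iff p g.1).mp g.2
        rw [← SemidirectProduct.inl_left_mul_inr_right g.1, hg, map_one, mul_one]
        rfl
      map_mul' := fun a b => Subtype.ext (map_mul _ a b)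
      continuous_toFun := (continuous_inlχ p).subtype_mk _
      continuous_invFun :=
        (Semidirect.continuous_left (isInducing_leftRightχ p)).comp continuous_subtype_val }
  exact IsSlimGroup.of_continuousMulEquiv' e hΓ

/-- **The group-level datum of the χ-twisted model, conditionally**: `GroupLevelData (curveχ p)` is inhabited
given `hΓ : IsSlimGroup Γ` and `hsc : SecondCountableTopology Π^tp_X` (binders; all other fields are theorems —
`galoisIdentification`, abc-iut-w5-d111's temperedness, the slimness above).
[cite: MochizukiSemiAnbd2006, Ex 3.10 p.43] -/
theorem nonempty_groupLevelData_curveχ (hΓ : IsSlimGroup Gfp) (hsc : SecondCountableTopology (PiTpχ p)) :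
    Nonempty (TemperedCurve.GroupLevelData (curveχ p)) := by
  have hker : ((curveχ p).augK (curveχ p).galoisIdentification).toMonoidHom.ker = (curveχ p).DeltaTemp :=
    (curveχ p).ker_augK _
  refine ⟨{ galEquiv := (curveχ p).galoisIdentification
            isTempered := isTempered_piTemp_curveχ p
            isTempered_ker := by rw [hker]; exact isTempered_deltaTemp_curveχ p
            isSlimGroup := isSlimGroup_PiTpχ p hΓ
            isSlimGroup_ker := by rw [hker]; exact isSlimGroup_deltaTempχ p hΓ
            secondCountableTopology := hsc }⟩

/-- Consequently (same binders) the bridge of abc-iut-L3-lead's ruling η fires at the χ-twisted model: a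
`TemperedArithmeticGroup ℚ_p`-datum of [SemiAnbd] Ex. 3.10 with `Π := Γ ⋊_χ G_{ℚ_p}`.
[cite: MochizukiSemiAnbd2006, Ex 3.10 p.43] -/
theorem exists_toTemperedArithmeticGroup_curveχ (hΓ : IsSlimGroup Gfp) (hsc : SecondCountableTopology (PiTpχ p)) :
    ∃ d : TemperedCurve.GroupLevelData (curveχ p), ((curveχ p).toTemperedArithmeticGroup d).Pi = PiTpχ p :=
  ⟨(nonempty_groupLevelData_curveχ p hΓ hsc).some, rfl⟩

end Literature.AnabelianGeometry.EtaleTheta.SettingModel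

end
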